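import Mathlib.AlgebraicGeometry.ZariskisMainTheorem
import Mathlib.AlgebraicGeometry.Normalization
import Mathlib.AlgebraicGeometry.Morphisms.Proper
import Mathlib.AlgebraicGeometry.Morphisms.Finite
import Mathlib.AlgebraicGeometry.Morphisms.Flat
import Mathlib.RingTheory.Flat.TorsionFree
import Mathlib.AlgebraicGeometry.FunctionField
import Mathlib.AlgebraicGeometry.Noetherian
import Mathlib.RingTheory.DiscreteValuationRing.Basic
import Literature.AlgebraicGeometry.Resolution.FiniteOverCompleteLocal
import HarnessLib

/-!
# [OURS · L1 W4.5(b)] EL♮ `EquisingularLiftNat` (stmt-ResolutionOfSingularities-20038), line `sections` —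
# kit lemma «FINITENESS FROM ONE QUASI-FINITE POINT over a complete DVR» (PushdownScheme kit, part 7)

Helper file `--supports stmt-ResolutionOfSingularities-20038` (cell `res-hironaka`, chain w45b, seat res-type-027; context:
res-L1-w45b-plan-1 ORDERS AMENDMENT 2 (b) 2026-08-27T06:53:05Z «T-MULTISEC … PushdownScheme kit»; the T-MULTISEC brick
itself is res-D-pv-003's `…NatMultisection.lean` — this file is the chain-independent lemma behind its «Henselian input»).
NOT a statement of any manuscript; OURS plumbing over Mathlib (Zariski's Main Theorem `Scheme.Hom.quasiFiniteLocus`,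
relative normalisation `Scheme.Hom.toNormalization` (Stacks 03GW), `IsFinite.of_isProper_of_locallyQuasiFinite`) and the
tree (`Resolution.FiniteOverCompleteLocal`, Matsumura Thm 8.15). AI-written, weaker than expert review. Kit parts 1–6:
p500010, p501971/p502697/p503206, p503621, p504082.

**Content.** `O` a COMPLETE discrete valuation ring, `T` an INTEGRAL scheme, `g : T → Spec O` PROPER, `b ∈ T` a point of
the special fibre at which `g` is quasi-finite ⇒ `g` is FINITE (`isFinite_of_isProper_of_quasiFiniteAt`); `Γ(T, 𝒪_T)` is
local; `b` is the only point of the special fibre; every point of `T` is `b` or the generic point; `T` is affine; `g` is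
flat once `O → Γ(T, 𝒪_T)` is injective. Route (no dimension formula, no rationality of `b`): a domain INTEGRAL over a
complete Noetherian local ring is local (`isLocalRing_of_isDomain_of_isIntegral_of_isAdicComplete`, via module-finite
subalgebras and Matsumura 8.15) ⇒ an integral scheme `N` integral over `Spec O` is a local scheme with at most one point
over the closed point (`opens_eq_top_of_isIntegralHom`, `eq_of_apply_eq_closedPoint_of_isIntegralHom`,
`eq_or_eq_genericPoint_of_isIntegralHom`) ⇒ the quasi-finite locus `U ∋ b` of `g`, an open subscheme of the (integral)
normalisation `N` of `Spec O` in `T`, is all of `N`, hence finite over `Spec O`, hence clopen in the irreducible `T`, hence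
`U = T` (`quasiFiniteLocus_eq_top_of_isProper_of_quasiFiniteAt`). Plus a TOPOLOGICAL CRITERION for the hypothesis
(`quasiFiniteAt_of_forall_specializes[_of_isLocallyNoetherian]`): `f` locally of finite type, `X` (locally) Noetherian,
`b` CLOSED and generalised by no other point of its fibre ⇒ `f` quasi-finite at `b` — e.g. `𝒪_{T,b}` a DVR in which a
uniformiser of `O` is non-zero. In the chain: `T = V(C)`, `C` the ideal of the closure of the germ point of a ramified
multisection through a closed point of a regular proper `P / O`; the conclusions are the «finite / C_s = {b} / two points /
flat» clauses of the (MS) shape (res-D-pv-013 2026-08-27T07:06:22Z) without a `k`-rationality hypothesis. [folklore]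
-/

set_option linter.dupNamespace false -- mandated namespace `Summit.<Summit>.<Problem>` of this single-conjunct summit

noncomputable section

open CategoryTheory AlgebraicGeometry TopologicalSpace Topology

universe u

namespace Summit.ResolutionOfSingularities.ResolutionOfSingularities.Cruxes.EquisingularLiftNat.Sections

/-! ## A domain integral over a complete Noetherian local ring is local -/

/-- **A domain which is integral over a complete Noetherian local ring is local** (for `b ∈ B` the subalgebra
`A[b]` is a module-finite local domain — Matsumura 8.15, tree lemma — so `b` or `1 - b` is a unit). [folklore] -/
theorem isLocalRing_of_isDomain_of_isIntegral_of_isAdicComplete (A B : Type u) [CommRing A]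
    [IsLocalRing A] [IsNoetherianRing A] [IsAdicComplete (IsLocalRing.maximalIdeal A) A] [CommRing B]
    [IsDomain B] [Algebra A B] [Algebra.IsIntegral A B] : IsLocalRing B := by
  refine IsLocalRing.of_isUnit_or_isUnit_one_sub_self fun b => ?_
  let S : Subalgebra A B := Algebra.adjoin A {b}
  haveI : Module.Finite A S := Algebra.finite_adjoin_simple_of_isIntegral (Algebra.IsIntegral.isIntegral b)
  haveI : IsLocalRing S :=
    Literature.AlgebraicGeometry.Resolution.isLocalRing_of_isDomain_of_finite_of_isAdicComplete A S
  have hb : b ∈ S := Algebra.self_mem_adjoin_singleton A b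
  rcases IsLocalRing.isUnit_or_isUnit_one_sub_self (⟨b, hb⟩ : S) with h | h
  · exact Or.inl (by simpa using h.map S.val)
  · exact Or.inr (by simpa using h.map S.val)

/-! ## Primes of a local domain integral over a DVR -/

/-- The primes of a local domain integral over a DVR are `0` and the maximal ideal. [folklore] -/
theorem eq_bot_or_eq_maximalIdeal_of_isIntegral (O Λ : Type*) [CommRing O] [IsDomain O]
    [IsDiscreteValuationRing O] [CommRing Λ] [IsDomain Λ] [IsLocalRing Λ] [Algebra O Λ]
    [Algebra.IsIntegral O Λ] (P : Ideal Λ) [P.IsPrime] : P = ⊥ ∨ P = IsLocalRing.maximalIdeal Λ := by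
  by_cases hQ : P.comap (algebraMap O Λ) = ⊥
  · exact Or.inl (Ideal.eq_bot_of_comap_eq_bot hQ)
  · right
    have hQmax : (P.comap (algebraMap O Λ)).IsMaximal :=
      (Ideal.comap_isPrime (algebraMap O Λ) P).isMaximal hQ
    exact IsLocalRing.eq_maximalIdeal (Ideal.isMaximal_of_isIntegral_of_isMaximal_comap P hQmax)

/-- In a local ring integral over a local `O`, a prime containing `𝔪_O` is the maximal ideal. [folklore] -/
theorem eq_maximalIdeal_of_isIntegral_of_map_le (O Λ : Type*) [CommRing O] [IsLocalRing O]
    [CommRing Λ] [IsLocalRing Λ] [Algebra O Λ] [Algebra.IsIntegral O Λ] (P : Ideal Λ) [P.IsPrime]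
    (hP : (IsLocalRing.maximalIdeal O).map (algebraMap O Λ) ≤ P) : P = IsLocalRing.maximalIdeal Λ := by
  have hQmax : (P.comap (algebraMap O Λ)).IsMaximal := by
    rw [← (IsLocalRing.maximalIdeal.isMaximal O).eq_of_le (Ideal.comap_isPrime (algebraMap O Λ) P).ne_top
      (Ideal.map_le_iff_le_comap.mp hP)]
    exact IsLocalRing.maximalIdeal.isMaximal O
  exact IsLocalRing.eq_maximalIdeal (Ideal.isMaximal_of_isIntegral_of_isMaximal_comap P hQmax)

/-! ## An integral affine scheme, integral over `Spec` of a complete local ring, is a local scheme -/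

section IntegralOver

variable {O : Type u} [CommRing O] {N : Scheme.{u}} (h : N ⟶ Spec (.of O))

/-- A morphism to `Spec O` factors through `toSpecΓ` and `Spec` of its structure map `O ≅ Γ(Spec O, ⊤) → Γ(N, ⊤)`
(as `Literature.AlgebraicGeometry.Resolution.eq_toSpecΓ_comp_SpecMap`, not imported: import cone). [folklore] -/
theorem eq_toSpecΓ_comp_SpecMap_ΓSpecIso_inv :
    h = N.toSpecΓ ≫ Spec.map ((Scheme.ΓSpecIso (.of O)).inv ≫ h.appTop) := by
  rw [Spec.map_comp, ← Scheme.toSpecΓ_naturality_assoc, toSpecΓ_SpecMap_ΓSpecIso_inv, Category.comp_id]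

/-- For an integral morphism `h : N → Spec O`, `N` affine, the structure map `O → Γ(N, ⊤)` is integral. [folklore] -/
theorem isIntegral_ΓSpecIso_inv_comp_appTop [IsIntegralHom h] [IsAffine N] :
    ((Scheme.ΓSpecIso (.of O)).inv ≫ h.appTop).hom.IsIntegral := by
  have H : IsIntegralHom (N.toSpecΓ ≫ Spec.map ((Scheme.ΓSpecIso (.of O)).inv ≫ h.appTop)) := by
    rw [← eq_toSpecΓ_comp_SpecMap_ΓSpecIso_inv h]; infer_instance
  rw [MorphismProperty.cancel_left_of_respectsIso @IsIntegralHom] at H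
  exact IsIntegralHom.SpecMap_iff.mp H

/-- `N.isoSpec.inv` undoes `N.toSpecΓ` on points (affine `N`). [folklore] -/
theorem isoSpec_inv_toSpecΓ_apply [IsAffine N] (x : N) : N.isoSpec.inv (N.toSpecΓ x) = x := by
  change (N.isoSpec.hom ≫ N.isoSpec.inv) x = x
  rw [Iso.hom_inv_id]; rfl

/-- For `h : N → Spec O` integral with `N` affine, `O` local and `Γ(N, ⊤)` local, a point of `N` over the
closed point of `Spec O` sits at the closed point of `Spec Γ(N, ⊤)` under `toSpecΓ`. [folklore] -/
theorem toSpecΓ_eq_closedPoint [IsLocalRing O] [IsAffine N] [IsLocalRing Γ(N, ⊤)] [IsIntegralHom h]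
    {n : N} (hn : h n = IsLocalRing.closedPoint O) : N.toSpecΓ n = IsLocalRing.closedPoint Γ(N, ⊤) := by
  algebraize [((Scheme.ΓSpecIso (.of O)).inv ≫ h.appTop).hom]
  haveI : Algebra.IsIntegral O Γ(N, ⊤) := ⟨isIntegral_ΓSpecIso_inv_comp_appTop h⟩
  have h1 : (Spec.map ((Scheme.ΓSpecIso (.of O)).inv ≫ h.appTop)) (N.toSpecΓ n) =
      IsLocalRing.closedPoint O := by
    rw [← Scheme.Hom.comp_apply, ← eq_toSpecΓ_comp_SpecMap_ΓSpecIso_inv h, hn]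
  have h2 := congrArg PrimeSpectrum.asIdeal h1
  rw [Spec.map_apply, PrimeSpectrum.comap_asIdeal] at h2
  exact PrimeSpectrum.ext
    (eq_maximalIdeal_of_isIntegral_of_map_le O Γ(N, ⊤) _ (Ideal.map_le_iff_le_comap.mpr h2.symm.le))

variable [IsLocalRing O] [IsNoetherianRing O] [IsAdicComplete (IsLocalRing.maximalIdeal O) O]

/-- **An integral scheme which is integral over `Spec` of a complete Noetherian local ring has LOCAL ring of
global sections** (it is affine with `Γ(N, ⊤)` a domain integral over `O`). [folklore] -/
theorem isLocalRing_Γ_of_isIntegralHom [IsIntegral N] [IsIntegralHom h] : IsLocalRing Γ(N, ⊤) := by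
  haveI : IsAffine N := isAffine_of_isAffineHom h
  algebraize [((Scheme.ΓSpecIso (.of O)).inv ≫ h.appTop).hom]
  haveI : Algebra.IsIntegral O Γ(N, ⊤) := ⟨isIntegral_ΓSpecIso_inv_comp_appTop h⟩
  exact isLocalRing_of_isDomain_of_isIntegral_of_isAdicComplete O Γ(N, ⊤)

/-- For `N` integral and integral over `Spec O` (`O` complete Noetherian local), an open subset of `N` containing a
point over the closed point of `Spec O` is all of `N` (every point specialises to that point). [folklore] -/
theorem opens_eq_top_of_isIntegralHom [IsIntegral N] [IsIntegralHom h] (V : N.Opens) {n : N}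
    (hnV : n ∈ V) (hn : h n = IsLocalRing.closedPoint O) : V = ⊤ := by
  haveI : IsAffine N := isAffine_of_isAffineHom h
  haveI : IsLocalRing Γ(N, ⊤) := isLocalRing_Γ_of_isIntegralHom h
  have hspec : ∀ x : N, x ⤳ n := fun x => by
    have hx : N.toSpecΓ x ⤳ N.toSpecΓ n := toSpecΓ_eq_closedPoint h hn ▸ IsLocalRing.specializes_closedPoint _
    simpa only [isoSpec_inv_toSpecΓ_apply] using hx.map N.isoSpec.inv.base.hom.continuous
  exact top_le_iff.mp fun x _ => (hspec x).mem_open V.isOpen hnV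

/-- For `N` integral and integral over `Spec O` (`O` complete Noetherian local), there is at most one point
of `N` over the closed point of `Spec O`. [folklore] -/
theorem eq_of_apply_eq_closedPoint_of_isIntegralHom [IsIntegral N] [IsIntegralHom h] {n x : N}
    (hn : h n = IsLocalRing.closedPoint O) (hx : h x = IsLocalRing.closedPoint O) : x = n := by
  haveI : IsAffine N := isAffine_of_isAffineHom h
  haveI : IsLocalRing Γ(N, ⊤) := isLocalRing_Γ_of_isIntegralHom h
  rw [← isoSpec_inv_toSpecΓ_apply (N := N) x, toSpecΓ_eq_closedPoint h hx, ← toSpecΓ_eq_closedPoint h hn,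
    isoSpec_inv_toSpecΓ_apply]

end IntegralOver

section IntegralOverDVR

variable {O : Type u} [CommRing O] [IsDomain O] [IsDiscreteValuationRing O]
  [IsAdicComplete (IsLocalRing.maximalIdeal O) O] {N : Scheme.{u}} (h : N ⟶ Spec (.of O))

/-- For `N` integral and integral over `Spec O`, `O` a complete discrete valuation ring, with a point `n`
over the closed point: every point of `N` is `n` or the generic point. [folklore] -/
theorem eq_or_eq_genericPoint_of_isIntegralHom [IsIntegral N] [IsIntegralHom h] {n : N}
    (hn : h n = IsLocalRing.closedPoint O) (x : N) : x = n ∨ x = genericPoint N := by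
  haveI : IsAffine N := isAffine_of_isAffineHom h
  haveI : IsLocalRing Γ(N, ⊤) := isLocalRing_Γ_of_isIntegralHom h
  algebraize [((Scheme.ΓSpecIso (.of O)).inv ≫ h.appTop).hom]
  haveI : Algebra.IsIntegral O Γ(N, ⊤) := ⟨isIntegral_ΓSpecIso_inv_comp_appTop h⟩
  have hpt := toSpecΓ_eq_closedPoint h hn
  rcases eq_bot_or_eq_maximalIdeal_of_isIntegral O Γ(N, ⊤) (N.toSpecΓ x).asIdeal with hbot | hmax
  · right
    have hgen : N.toSpecΓ (genericPoint N) = N.toSpecΓ x := by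
      rw [genericPoint_eq_of_isOpenImmersion, genericPoint_eq_bot_of_affine]
      exact PrimeSpectrum.ext hbot.symm
    rw [← isoSpec_inv_toSpecΓ_apply (N := N) x, ← hgen, isoSpec_inv_toSpecΓ_apply]
  · left
    have : N.toSpecΓ x = N.toSpecΓ n := by rw [hpt]; exact PrimeSpectrum.ext hmax
    rw [← isoSpec_inv_toSpecΓ_apply (N := N) x, this, isoSpec_inv_toSpecΓ_apply]

end IntegralOverDVR

variable {O : Type u} [CommRing O] [IsDomain O] [IsDiscreteValuationRing O]
  [IsAdicComplete (IsLocalRing.maximalIdeal O) O] {T : Scheme.{u}} [IsIntegral T] (g : T ⟶ Spec (.of O)) [IsProper g]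

/-- **Key step.** `O` a complete DVR, `T` integral, `g : T → Spec O` proper and quasi-finite at a point `b`
of the special fibre ⇒ `g` is quasi-finite everywhere: the quasi-finite locus is an open subscheme of the
relative normalisation `N` (Zariski's Main Theorem), `N` is integral and integral over `Spec O`, hence a local
scheme whose only open containing the image of `b` is `N` itself; so the locus is finite over `Spec O`, hence
closed in `T`, hence everything. [folklore] -/
theorem quasiFiniteLocus_eq_top_of_isProper_of_quasiFiniteAt {b : T} (hb : g b = IsLocalRing.closedPoint O)
    (hqf : g.QuasiFiniteAt b) : g.quasiFiniteLocus = ⊤ := by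
  set U := g.quasiFiniteLocus with hU
  have hbU : b ∈ U := hqf
  -- the open immersion of the quasi-finite locus into the relative normalisation is onto
  set e := U.ι ≫ g.toNormalization with he
  have hfac : U.ι ≫ g = e ≫ g.fromNormalization := by
    simp only [he, Category.assoc, Scheme.Hom.toNormalization_fromNormalization]
  have hrange : e.opensRange = ⊤ := by
    refine opens_eq_top_of_isIntegralHom g.fromNormalization e.opensRange (n := e ⟨b, hbU⟩) ⟨_, rfl⟩ ?_
    rw [← Scheme.Hom.comp_apply, ← hfac, Scheme.Hom.comp_apply, Scheme.Opens.ι_apply]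
    exact hb
  haveI : IsIso e := isIso_of_isOpenImmersion_of_opensRange_eq_top e hrange
  haveI : IsIntegralHom (U.ι ≫ g) := by rw [hfac]; infer_instance
  haveI : IsFinite (U.ι ≫ g) :=
    (IsFinite.iff_isIntegralHom_and_locallyOfFiniteType _).mpr ⟨inferInstance, inferInstance⟩
  haveI : IsProper U.ι := IsProper.of_comp U.ι g
  have hclosed : IsClosed (U : Set T) := by
    rw [← Scheme.Opens.range_ι]; exact U.ι.isClosedMap.isClosed_range
  have huniv : (U : Set T) = Set.univ := IsClopen.eq_univ ⟨hclosed, U.isOpen⟩ ⟨b, hbU⟩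
  exact SetLike.coe_injective (huniv.trans (TopologicalSpace.Opens.coe_top).symm)

/-- **An integral scheme, proper over a complete discrete valuation ring, with a quasi-finite point in the
special fibre is FINITE over the base** (proper and locally quasi-finite, Mathlib
`IsFinite.of_isProper_of_locallyQuasiFinite`). [folklore] -/
theorem isFinite_of_isProper_of_quasiFiniteAt {b : T} (hb : g b = IsLocalRing.closedPoint O)
    (hqf : g.QuasiFiniteAt b) : IsFinite g := by
  haveI : LocallyQuasiFinite g :=
    (Scheme.Hom.quasiFiniteLocus_eq_top_iff g).mp (quasiFiniteLocus_eq_top_of_isProper_of_quasiFiniteAt g hb hqf)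
  exact IsFinite.of_isProper_of_locallyQuasiFinite g

/-- In the situation of `isFinite_of_isProper_of_quasiFiniteAt`, `Γ(T, ⊤)` is a local ring. [folklore] -/
theorem isLocalRing_of_isProper_of_quasiFiniteAt {b : T} (hb : g b = IsLocalRing.closedPoint O)
    (hqf : g.QuasiFiniteAt b) : IsLocalRing Γ(T, ⊤) := by
  haveI := isFinite_of_isProper_of_quasiFiniteAt g hb hqf
  exact isLocalRing_Γ_of_isIntegralHom g

/-- In the situation of `isFinite_of_isProper_of_quasiFiniteAt`, every point of `T` is `b` or the generic
point of `T`. [folklore] -/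
theorem eq_or_eq_genericPoint_of_isProper_of_quasiFiniteAt {b : T} (hb : g b = IsLocalRing.closedPoint O)
    (hqf : g.QuasiFiniteAt b) (t : T) : t = b ∨ t = genericPoint T := by
  haveI := isFinite_of_isProper_of_quasiFiniteAt g hb hqf
  exact eq_or_eq_genericPoint_of_isIntegralHom g hb t

/-- In the situation of `isFinite_of_isProper_of_quasiFiniteAt`, `b` is the only point of the special fibre.
[folklore] -/
theorem eq_of_apply_eq_closedPoint_of_isProper_of_quasiFiniteAt
    {b : T} (hb : g b = IsLocalRing.closedPoint O)
    (hqf : g.QuasiFiniteAt b) {t : T} (ht : g t = IsLocalRing.closedPoint O) : t = b := by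
  haveI := isFinite_of_isProper_of_quasiFiniteAt g hb hqf
  exact eq_of_apply_eq_closedPoint_of_isIntegralHom g hb ht

/-- In the situation of `isFinite_of_isProper_of_quasiFiniteAt`, the special fibre is `{b}` as a set.
[folklore] -/
theorem preimage_closedPoint_eq_singleton_of_isProper_of_quasiFiniteAt
    {b : T} (hb : g b = IsLocalRing.closedPoint O)
    (hqf : g.QuasiFiniteAt b) : g ⁻¹' {IsLocalRing.closedPoint O} = {b} := by
  ext t
  simp only [Set.mem_preimage, Set.mem_singleton_iff]
  exact ⟨fun ht => eq_of_apply_eq_closedPoint_of_isProper_of_quasiFiniteAt g hb hqf ht, fun ht => ht ▸ hb⟩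

/-- In the situation of `isFinite_of_isProper_of_quasiFiniteAt`, `T` is affine. [folklore] -/
theorem isAffine_of_isProper_of_quasiFiniteAt {b : T} (hb : g b = IsLocalRing.closedPoint O)
    (hqf : g.QuasiFiniteAt b) : IsAffine T := by
  haveI := isFinite_of_isProper_of_quasiFiniteAt g hb hqf
  exact isAffine_of_isAffineHom g

/-- In the situation of `isFinite_of_isProper_of_quasiFiniteAt`, if moreover the structure map
`O → Γ(T, ⊤)` is injective (e.g. `g` dominant), then `g` is FLAT (`Γ(T, ⊤)` is a torsion-free module over the
Dedekind domain `O`). [folklore] -/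
theorem flat_of_isProper_of_quasiFiniteAt_of_injective {b : T} (hb : g b = IsLocalRing.closedPoint O)
    (hqf : g.QuasiFiniteAt b)
    (hinj : Function.Injective ((Scheme.ΓSpecIso (.of O)).inv ≫ g.appTop).hom) : Flat g := by
  haveI := isFinite_of_isProper_of_quasiFiniteAt g hb hqf
  haveI : IsAffine T := isAffine_of_isAffineHom g
  rw [HasRingHomProperty.iff_of_isAffine (P := @Flat),
    ← RingHom.Flat.respectsIso.cancel_left_isIso (Scheme.ΓSpecIso (.of O)).inv g.appTop]
  algebraize [((Scheme.ΓSpecIso (.of O)).inv ≫ g.appTop).hom]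
  haveI : Module.IsTorsionFree O Γ(T, ⊤) := by
    refine Module.IsTorsionFree.of_smul_eq_zero fun r m hrm => ?_
    rw [Algebra.smul_def, mul_eq_zero] at hrm
    rcases hrm with hr | hm
    · left
      apply hinj
      rw [map_zero]
      exact hr
    · exact Or.inr hm
  exact (inferInstance : Module.Flat O Γ(T, ⊤))

/-! ## A topological criterion for quasi-finiteness at a closed point -/

section QuasiFiniteCriterion

variable {X Y : Scheme.{u}} (f : X ⟶ Y)

/-- In a Noetherian space `X`, for `f : X → Y` continuous (here a morphism of schemes) and a CLOSED point `b`
which no other point of its fibre `f⁻¹(f b)` generalises, `{b}` is open in the fibre: every irreducible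
component of the fibre through `b` has a generic point (in `X`) lying in the fibre and generalising `b`, so it
is `{b}`, and the other (finitely many, closed) components miss `b`. [folklore] -/
theorem isOpen_singleton_preimage_of_forall_specializes [NoetherianSpace X] {b : X}
    (hbc : IsClosed ({b} : Set X)) (H : ∀ t : X, f t = f b → t ⤳ b → t = b) :
    IsOpen ({⟨b, rfl⟩} : Set (f ⁻¹' {f b})) := by
  set S : Set X := f ⁻¹' {f b} with hS
  set b₀ : S := ⟨b, rfl⟩ with hb₀
  -- (A) every irreducible component of the fibre through `b` is `{b}`
  have hA : ∀ Z ∈ irreducibleComponents S, b₀ ∈ Z → Z = {b₀} := by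
    intro Z hZ hbZ
    have hZ' : IsIrreducible (Subtype.val '' Z : Set X) :=
      hZ.1.image _ continuous_subtype_val.continuousOn
    set η := hZ'.genericPoint with hη
    have hgen : IsGenericPoint η (closure (Subtype.val '' Z : Set X)) :=
      hZ'.isGenericPoint_genericPoint_closure
    have hbZ' : b ∈ (Subtype.val '' Z : Set X) := ⟨b₀, hbZ, rfl⟩
    have hηb : η ⤳ b := hgen.specializes (subset_closure hbZ')
    have hfη : f η = f b := by
      refine (Specializes.antisymm (hηb.map f.continuous) ?_).eq
      rw [specializes_iff_mem_closure]
      have h1 : f η ∈ f '' closure (Subtype.val '' Z : Set X) := ⟨η, hgen.mem, rfl⟩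
      have h2 : f '' (Subtype.val '' Z : Set X) ⊆ {f b} := by
        rintro _ ⟨_, ⟨z, -, rfl⟩, rfl⟩
        exact z.2
      exact (closure_mono h2) (image_closure_subset_closure_image f.continuous h1)
    have hη_eq : η = b := H η hfη hηb
    have hZsub : (Subtype.val '' Z : Set X) ⊆ {b} := by
      rw [← hbc.closure_eq, ← hη_eq, hgen.def]
      exact subset_closure
    refine Set.Subset.antisymm (fun z hz => ?_) (Set.singleton_subset_iff.mpr hbZ)
    exact Subtype.ext (hZsub ⟨z, hz, rfl⟩)
  -- (B) the complement of the other (finitely many, closed) components is `{b}`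
  set K : Set S := ⋃ Z ∈ {Z ∈ irreducibleComponents S | b₀ ∉ Z}, Z with hK
  have hKc : IsClosed K := by
    refine Set.Finite.isClosed_biUnion ?_ fun Z hZ => isClosed_of_mem_irreducibleComponents Z hZ.1
    exact NoetherianSpace.finite_irreducibleComponents.subset fun Z hZ => hZ.1
  have hKb : Kᶜ = {b₀} := by
    refine Set.Subset.antisymm (fun t ht => ?_) ?_
    · by_contra hne
      have hZt := irreducibleComponent_mem_irreducibleComponents t
      by_cases hbt : b₀ ∈ irreducibleComponent t
      · exact hne (by
          have := hA _ hZt hbt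
          exact (this ▸ mem_irreducibleComponent : t ∈ ({b₀} : Set S)))
      · exact ht (Set.mem_biUnion (show irreducibleComponent t ∈ {Z ∈ irreducibleComponents S | b₀ ∉ Z}
          from ⟨hZt, hbt⟩) mem_irreducibleComponent)
    · rintro _ rfl hmem
      obtain ⟨Z, hZ, hbZ⟩ := Set.mem_iUnion₂.mp hmem
      exact hZ.2 hbZ
  rw [← hKb]
  exact hKc.isOpen_compl

/-- **Topological criterion for quasi-finiteness at a closed point.** `f` locally of finite type, `X` a
Noetherian space, `b` a closed point of `X` which no other point of its fibre generalises ⇒ `f` is quasi-finite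
at `b` (Mathlib `Scheme.Hom.quasiFiniteAt_iff_isOpen_singleton_asFiber`). Typical use: `𝒪_{X,b}` is a discrete
valuation ring in which the image of the maximal ideal of the base is non-zero. [folklore] -/
theorem quasiFiniteAt_of_forall_specializes [LocallyOfFiniteType f] [NoetherianSpace X] {b : X}
    (hbc : IsClosed ({b} : Set X)) (H : ∀ t : X, f t = f b → t ⤳ b → t = b) : f.QuasiFiniteAt b := by
  rw [Scheme.Hom.quasiFiniteAt_iff_isOpen_singleton_asFiber]
  have hopen := isOpen_singleton_preimage_of_forall_specializes f hbc H
  have heq : (f.fiberHomeo (f b)) ⁻¹' {⟨b, rfl⟩} = {f.asFiber b} := by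
    ext z
    simp only [Set.mem_preimage, Set.mem_singleton_iff, Scheme.Hom.asFiber]
    constructor
    · intro hz
      apply (f.fiberHomeo (f b)).injective
      rw [hz, Homeomorph.apply_symm_apply]
    · rintro rfl
      exact Homeomorph.apply_symm_apply _ _
  rw [← heq]
  exact hopen.preimage (f.fiberHomeo (f b)).continuous

/-- **Topological criterion for quasi-finiteness at a closed point**, locally Noetherian source (restrict to
an affine open neighbourhood, Mathlib `Scheme.Hom.quasiFiniteAt_comp_iff_of_isOpenImmersion`). [folklore] -/
theorem quasiFiniteAt_of_forall_specializes_of_isLocallyNoetherian [LocallyOfFiniteType f]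
    [IsLocallyNoetherian X] {b : X} (hbc : IsClosed ({b} : Set X))
    (H : ∀ t : X, f t = f b → t ⤳ b → t = b) : f.QuasiFiniteAt b := by
  obtain ⟨_, ⟨V : X.Opens, hV, rfl⟩, hbV, -⟩ :=
    X.isBasis_affineOpens.exists_subset_of_mem_open (Set.mem_univ b) isOpen_univ
  haveI : IsNoetherianRing Γ(X, V) := IsLocallyNoetherian.component_noetherian ⟨V, hV⟩
  haveI : NoetherianSpace V := noetherianSpace_of_isAffineOpen V hV
  have hbc' : IsClosed ({⟨b, hbV⟩} : Set V) := by
    have heq : ({⟨b, hbV⟩} : Set V) = Subtype.val ⁻¹' {b} := by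
      ext t
      constructor
      · rintro rfl; rfl
      · intro h; exact Subtype.ext h
    rw [heq]
    exact hbc.preimage continuous_subtype_val
  have H' : ∀ t : V, (V.ι ≫ f) t = (V.ι ≫ f) ⟨b, hbV⟩ → t ⤳ ⟨b, hbV⟩ → t = ⟨b, hbV⟩ := by
    intro t ht hsp
    apply Subtype.ext
    refine H t.1 ?_ (hsp.map continuous_subtype_val)
    simpa only [Scheme.Hom.comp_apply, Scheme.Opens.ι_apply] using ht
  have := quasiFiniteAt_of_forall_specializes (V.ι ≫ f) hbc' H'
  rwa [Scheme.Hom.quasiFiniteAt_comp_iff_of_isOpenImmersion] at this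

end QuasiFiniteCriterion

end Summit.ResolutionOfSingularities.ResolutionOfSingularities.Cruxes.EquisingularLiftNat.Sections
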